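import Mathlib
import Summits.QuantumFields.QCD.Theses.PauliWegnerSea
import Literature.MathematicalPhysics.QuantumFieldTheory.QCDHeavyQuarkPropagator
import Literature.MathematicalPhysics.QuantumFieldTheory.QCDWickMinorMeasurability
import Literature.MathematicalPhysics.QuantumFieldTheory.QCDPhaseQuenchedPositivity

/-!
# Stub `stub_upper_of_secondMomentDecay` of line `crossing-split-integrability`
(crux `Summit.QuantumFields.QCD.Theses.PauliWegnerSea.PhaseQuenchedFlavourDecay` =
`Summit.QuantumFields.QCD.Theses.WilsonMobilityGap.PhaseQuenchedFlavourDecay`,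
item stmt-QuantumFields-9151)

Exponential decay (with bounded amplitude and integrability) of the phase-quenched SECOND moment
of the colour–spin block of the quark propagator implies the crux hypothesis UPPER with
`s = 1/2`: on the phase-quenched probability space `qcdLatticeMeasure`, the elementary pointwise
bound `X^{1/2} ≤ X² / t³ + t` (`t > 0`), Cauchy–Schwarz `X₁² ≤ 144 · X₂` on the `144`-term block
sum, and the choice `t⁴ = K e^{-δ a ‖v‖}` give `⟨X₁^{1/2}⟩₊ ≤ 145 K^{1/4} e^{-(δ/4) a ‖v‖}`.
-/

noncomputable section

namespace Summit.QuantumFields.QCD.Cruxes.PhaseQuenchedFlavourDecay.CrossingSplitIntegrability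

open scoped BigOperators
open MeasureTheory Filter
open Literature.MathematicalPhysics.QuantumFieldTheory Literature.MathematicalPhysics.QuantumLattice
  Literature.Probability.LatticeModels

/-- Elementary pointwise bound replacing Jensen: `u^{1/2} ≤ u² / t³ + t` for `u ≥ 0`, `t > 0`
(equivalently `r t³ ≤ r⁴ + t⁴` with `r = √u`, a weighted AM–GM). -/
private theorem rpow_half_le_sq_div_add {u t : ℝ} (hu : 0 ≤ u) (ht : 0 < t) :
    u ^ (1 / 2 : ℝ) ≤ u ^ 2 / t ^ 3 + t := by
  rw [← Real.sqrt_eq_rpow]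
  have hr0 : 0 ≤ Real.sqrt u := Real.sqrt_nonneg u
  have hu2 : u ^ 2 = Real.sqrt u ^ 4 := by
    rw [show (4 : ℕ) = 2 * 2 from rfl, pow_mul, Real.sq_sqrt hu]
  rw [hu2, div_add' _ _ _ (pow_ne_zero 3 ht.ne'), le_div_iff₀ (pow_pos ht 3)]
  nlinarith [sq_nonneg (Real.sqrt u ^ 2 - t ^ 2 / 2),
    mul_nonneg (sq_nonneg t) (sq_nonneg (Real.sqrt u - t / 2)), pow_nonneg ht.le 4, hr0]

/-- Cauchy–Schwarz on the `3 · 4 · 3 · 4 = 144`-term colour–spin block: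
`(Σ y)² ≤ 144 Σ y²`. -/
private theorem sq_sum_four_le (y : Fin 3 → Fin 4 → Fin 3 → Fin 4 → ℝ) :
    (∑ a, ∑ i, ∑ b, ∑ j, y a i b j) ^ 2 ≤ 144 * ∑ a, ∑ i, ∑ b, ∑ j, y a i b j ^ 2 := by
  have h1 : ∑ a, ∑ i, ∑ b, ∑ j, y a i b j =
      ∑ p : Fin 3 × Fin 4 × Fin 3 × Fin 4, y p.1 p.2.1 p.2.2.1 p.2.2.2 := by
    simp only [Fintype.sum_prod_type]
  have h2 : ∑ a, ∑ i, ∑ b, ∑ j, y a i b j ^ 2 =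
      ∑ p : Fin 3 × Fin 4 × Fin 3 × Fin 4, y p.1 p.2.1 p.2.2.1 p.2.2.2 ^ 2 := by
    simp only [Fintype.sum_prod_type]
  rw [h1, h2]
  calc (∑ p : Fin 3 × Fin 4 × Fin 3 × Fin 4, y p.1 p.2.1 p.2.2.1 p.2.2.2) ^ 2
      ≤ (Finset.univ : Finset (Fin 3 × Fin 4 × Fin 3 × Fin 4)).card *
          ∑ p : Fin 3 × Fin 4 × Fin 3 × Fin 4, y p.1 p.2.1 p.2.2.1 p.2.2.2 ^ 2 :=
        sq_sum_le_card_mul_sum_sq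
    _ = 144 * ∑ p : Fin 3 × Fin 4 × Fin 3 × Fin 4, y p.1 p.2.1 p.2.2.1 p.2.2.2 ^ 2 := by
        rw [Finset.card_univ, Fintype.card_prod, Fintype.card_prod, Fintype.card_prod,
          Fintype.card_fin, Fintype.card_fin]
        norm_num

/-- The probabilistic core: on a probability space, if the block sum of squares `X₂` is integrable
with `∫ X₂ ≤ t⁴` (`t > 0`), then `∫ X₁^{1/2} ≤ 145 t` for the block sum `X₁` of the (nonnegative)
entries — pointwise `X₁^{1/2} ≤ X₁²/t³ + t ≤ 144 X₂/t³ + t`, then integrate. -/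
private theorem integral_sum_rpow_half_le {Ω : Type*} [MeasurableSpace Ω] {μ : Measure Ω}
    [IsProbabilityMeasure μ] (x : Ω → Fin 3 → Fin 4 → Fin 3 → Fin 4 → ℝ)
    (hx0 : ∀ ω a i b j, 0 ≤ x ω a i b j) {t : ℝ} (ht : 0 < t)
    (hint : Integrable (fun ω => ∑ a, ∑ i, ∑ b, ∑ j, x ω a i b j ^ 2) μ)
    (hI : ∫ ω, (∑ a, ∑ i, ∑ b, ∑ j, x ω a i b j ^ 2) ∂μ ≤ t ^ 4) :
    ∫ ω, (∑ a, ∑ i, ∑ b, ∑ j, x ω a i b j) ^ (1 / 2 : ℝ) ∂μ ≤ 145 * t := by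
  have hsum0 : ∀ ω, 0 ≤ ∑ a, ∑ i, ∑ b, ∑ j, x ω a i b j := fun ω =>
    Finset.sum_nonneg fun a _ => Finset.sum_nonneg fun i _ => Finset.sum_nonneg fun b _ =>
      Finset.sum_nonneg fun j _ => hx0 ω a i b j
  have hpt : ∀ ω, (∑ a, ∑ i, ∑ b, ∑ j, x ω a i b j) ^ (1 / 2 : ℝ) ≤
      144 / t ^ 3 * (∑ a, ∑ i, ∑ b, ∑ j, x ω a i b j ^ 2) + t := by
    intro ω
    calc (∑ a, ∑ i, ∑ b, ∑ j, x ω a i b j) ^ (1 / 2 : ℝ)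
        ≤ (∑ a, ∑ i, ∑ b, ∑ j, x ω a i b j) ^ 2 / t ^ 3 + t := rpow_half_le_sq_div_add (hsum0 ω) ht
      _ ≤ (144 * ∑ a, ∑ i, ∑ b, ∑ j, x ω a i b j ^ 2) / t ^ 3 + t := by
          gcongr
          exact sq_sum_four_le (x ω)
      _ = 144 / t ^ 3 * (∑ a, ∑ i, ∑ b, ∑ j, x ω a i b j ^ 2) + t := by ring
  have hnn : ∀ ω, 0 ≤ (∑ a, ∑ i, ∑ b, ∑ j, x ω a i b j) ^ (1 / 2 : ℝ) := fun ω =>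
    Real.rpow_nonneg (hsum0 ω) _
  have hgi : Integrable (fun ω => 144 / t ^ 3 * (∑ a, ∑ i, ∑ b, ∑ j, x ω a i b j ^ 2) + t) μ :=
    (hint.const_mul _).add (integrable_const _)
  have ht3 : t ^ 3 ≠ 0 := pow_ne_zero 3 ht.ne'
  calc ∫ ω, (∑ a, ∑ i, ∑ b, ∑ j, x ω a i b j) ^ (1 / 2 : ℝ) ∂μ
      ≤ ∫ ω, (144 / t ^ 3 * (∑ a, ∑ i, ∑ b, ∑ j, x ω a i b j ^ 2) + t) ∂μ :=
        integral_mono_of_nonneg (Eventually.of_forall hnn) hgi (Eventually.of_forall hpt)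
    _ = 144 / t ^ 3 * ∫ ω, (∑ a, ∑ i, ∑ b, ∑ j, x ω a i b j ^ 2) ∂μ + t := by
        rw [integral_add (hint.const_mul _) (integrable_const _), integral_const_mul,
          integral_const, probReal_univ, one_smul]
    _ ≤ 144 / t ^ 3 * t ^ 4 + t := by gcongr
    _ = 145 * t := by
        field_simp
        ring

/-- W9: exponential decay of the phase-quenched second moment of the propagator (all directions, with integrability) implies UPPER (Jensen/Lyapunov under the phase-quenched probability measure + Cauchy–Schwarz on the 144-term sum). -/
theorem stub_upper_of_secondMomentDecay :
    ∀ (Nf : ℕ) (reg : QCDRegularisation Nf) (m : Fin Nf → ℝ), (∃ δ C₂ : ℝ, 0 < δ ∧ ∀ᶠ k in atTop, ∀ S : ℕ, reg.L k ≤ S → ∀ (f : Fin Nf) (v : Literature.Probability.LatticeModels.Site 4), v ∈ box 4 S → Integrable (fun U : GaugeConfig 4 (2 * S + 1) SU3 => ∑ a : Fin 3, ∑ i : Fin 4, ∑ b : Fin 3, ∑ j : Fin 4, ‖(diracMatrix U fun fl => reg.mcrit k + reg.a k * m fl / reg.Zm k)⁻¹ (quarkEquiv (f, (Torus.proj (2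 * S + 1) 0, a, i))) (quarkEquiv (f, (Torus.proj (2 * S + 1) (v), b, j)))‖ ^ (2 : ℕ)) (qcdLatticeMeasure (2 * S + 1) (reg.β k) fun fl => reg.mcrit k + reg.a k * m fl / reg.Zm k) ∧ qcdPhaseQuenchedExpect (reg.β k) (2 * S + 1) (fun fl => reg.mcrit k + reg.a k * m fl / reg.Zm k) (fun U : GaugeConfig 4 (2 * S + 1) SU3 => ∑ a : Fin 3, ∑ i : Fin 4, ∑ b : Fin 3, ∑ j : Fin 4, ‖(diracMatrix U fun fl => reg.mcrit k + reg.a k * m fl / reg.Zm k)⁻¹ (quarkEquiv (f, (Torus.proj (2 * S + 1) 0, a, i))) (quarkEquiv (f, (Torus.proj (2 * S + 1) (v), b, j)))‖ ^ (2 : ℕ)) ≤ C₂ * Real.exp (-(δ * (reg.a k * ‖v‖)))) → ∃ s δ C : ℝ, 0 < s ∧ s < 1 ∧ 0 < δ ∧ ∀ᶠ k in atTop, ∀ S : ℕ, reg.L k ≤ S → ∀ (f : Fin Nf) (v : Literature.Probability.LatticeModels.Site 4), v ∈ box 4 S → (∫ U : GaugeConfig 4 (2 * S + 1) (Matrix.specialUnitaryGroup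 (Fin 3) ℂ), ‖(diracMatrix U fun fl => reg.mcrit k + reg.a k * m fl / reg.Zm k).det‖ * (∑ a : Fin 3, ∑ i : Fin 4, ∑ b : Fin 3, ∑ j : Fin 4, ‖(diracMatrix U fun fl => reg.mcrit k + reg.a k * m fl / reg.Zm k)⁻¹ (quarkEquiv (f, (Torus.proj (2 * S + 1) 0, a, i))) (quarkEquiv (f, (Torus.proj (2 * S + 1) (v), b, j)))‖) ^ s ∂(wilsonMeasure (fundamentalRep (Fin 3)) (reg.β k))) / (∫ U : GaugeConfig 4 (2 * S + 1) (Matrix.specialUnitaryGroup (Fin 3) ℂ), ‖(diracMatrix U fun fl => reg.mcrit k + reg.a k * m fl / reg.Zm k).det‖ ∂(wilsonMeasure (fundamentalRep (Fin 3)) (reg.β k))) ≤ C * Real.exp (-(δ * (reg.a k * ‖v‖))) := by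
  intro Nf reg m hSMD
  obtain ⟨δ, C₂, hδ, hev⟩ := hSMD
  -- an amplitude dominating `C₂` and positive
  obtain ⟨K, hK⟩ : ∃ K : ℝ, K = max C₂ 0 + 1 := ⟨_, rfl⟩
  have hK0 : 0 < K := by rw [hK]; positivity
  have hC₂K : C₂ ≤ K := by
    rw [hK]; exact (le_max_left _ _).trans (le_add_of_nonneg_right zero_le_one)
  refine ⟨1 / 2, δ / 4, 145 * K ^ (1 / 4 : ℝ), by norm_num, by norm_num, by positivity, ?_⟩
  refine hev.mono fun k hk S hS f v hv => ?_
  obtain ⟨hint, hle⟩ := hk S hS f v hv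
  set mq : Fin Nf → ℝ := fun fl => reg.mcrit k + reg.a k * m fl / reg.Zm k with hmq
  haveI := isProbabilityMeasure_qcdLatticeMeasure_all (S := 2 * S + 1) (reg.β k) mq
  -- the parameter `t` with `t⁴ = K e^{-δ a ‖v‖}`
  obtain ⟨t, ht⟩ : ∃ t : ℝ, t = K ^ (1 / 4 : ℝ) * Real.exp (-(δ / 4 * (reg.a k * ‖v‖))) :=
    ⟨_, rfl⟩
  have ht0 : 0 < t := by rw [ht]; positivity
  have ht4 : t ^ 4 = K * Real.exp (-(δ * (reg.a k * ‖v‖))) := by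
    rw [ht, mul_pow]
    congr 1
    · rw [← Real.rpow_natCast, ← Real.rpow_mul hK0.le]
      norm_num
    · rw [← Real.exp_nat_mul]
      congr 1
      push_cast
      ring
  -- the second-moment hypothesis as `∫ X₂ ∂(qcdLatticeMeasure) ≤ t⁴`
  have hI : ∫ U, (∑ a : Fin 3, ∑ i : Fin 4, ∑ b : Fin 3, ∑ j : Fin 4,
      ‖(diracMatrix U mq)⁻¹ (quarkEquiv (f, (Torus.proj (2 * S + 1) 0, a, i)))
        (quarkEquiv (f, (Torus.proj (2 * S + 1) (v), b, j)))‖ ^ (2 : ℕ))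
        ∂(qcdLatticeMeasure (2 * S + 1) (reg.β k) mq) ≤ t ^ 4 := by
    rw [qcdPhaseQuenchedExpect_eq_integral_qcdLatticeMeasure] at hle
    refine hle.trans ?_
    rw [ht4]
    exact mul_le_mul_of_nonneg_right hC₂K (Real.exp_pos _).le
  -- the bound for the phase-quenched expectation of `X₁^{1/2}`
  have key : qcdPhaseQuenchedExpect (reg.β k) (2 * S + 1) mq
      (fun U : GaugeConfig 4 (2 * S + 1) SU3 => (∑ a : Fin 3, ∑ i : Fin 4, ∑ b : Fin 3, ∑ j : Fin 4,
        ‖(diracMatrix U mq)⁻¹ (quarkEquiv (f, (Torus.proj (2 * S + 1) 0, a, i)))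
          (quarkEquiv (f, (Torus.proj (2 * S + 1) (v), b, j)))‖) ^ (1 / 2 : ℝ)) ≤
      145 * K ^ (1 / 4 : ℝ) * Real.exp (-(δ / 4 * (reg.a k * ‖v‖))) := by
    rw [qcdPhaseQuenchedExpect_eq_integral_qcdLatticeMeasure]
    refine (integral_sum_rpow_half_le (μ := qcdLatticeMeasure (2 * S + 1) (reg.β k) mq)
      (fun (U : GaugeConfig 4 (2 * S + 1) SU3) (a : Fin 3) (i : Fin 4) (b : Fin 3) (j : Fin 4) =>
        ‖(diracMatrix U mq)⁻¹ (quarkEquiv (f, (Torus.proj (2 * S + 1) 0, a, i)))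
          (quarkEquiv (f, (Torus.proj (2 * S + 1) (v), b, j)))‖)
      (fun _ _ _ _ _ => norm_nonneg _) ht0 hint hI).trans_eq ?_
    rw [ht]
    ring
  rw [qcdPhaseQuenchedExpect_eq_div] at key
  exact key

end Summit.QuantumFields.QCD.Cruxes.PhaseQuenchedFlavourDecay.CrossingSplitIntegrability

end
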